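import Summits.QuantumFields.YangMills.Theses.DyadicChessboard
import HarnessLib

/-!
# Route `DyadicChessboard`, `Assembly` (stmt-QuantumFields-23372) — BY NAME

`DyadicArrayCeiling → OddDyadicCoincidence → FloorsC → ChessboardTransfer → DyadicCalibration → the leaf
HypercubicOSDataFromInfiniteVolume` (planner ym-idea-11 g9): modus ponens — the transfer turns the array ceiling into the
factorial dyadic ceilings, which the calibration consumes together with the coincidence and the floors.

Free-hands width seat `ym-line-sfw-p2-w4` (cell ym-idea-1).  Pure logic; R2a-IV RECORD rung — no summit, rung or crux is
proved here and nothing about the Yang–Mills mass gap follows.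
-/

set_option autoImplicit false

namespace Summit.QuantumFields.YangMills.Theorems

/-- **`DyadicChessboard.Assembly`** (item stmt-QuantumFields-23372), BY NAME. [folklore] -/
theorem dyadicChessboard_assembly_proof : Summit.QuantumFields.YangMills.Theses.DyadicChessboard.Assembly :=
  fun hA hO hF hT hCal => hCal (hT hA) hO hF

end Summit.QuantumFields.YangMills.Theorems
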